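import Mathlib
import HarnessLib
import Literature.MathematicalPhysics.QuantumFieldTheory.ConstructiveQFTWave0
import Literature.MathematicalPhysics.QuantumLattice.AbelianMagneticFlux
import Literature.Topology.FourManifolds.TorusMapDegree
import Summits.Ventures.LatticeQCDFlow.Scaling.CircleBallVolume
import Summits.Ventures.LatticeQCDFlow.Scaling.IsoperimetricTransfer

/-!
# LatticeQCDFlow / Scaling — the topological collar of 2-d compact `U(1)` and the `1/ε` transport law (v2.6, (C2b′))

HONEST FRAMING: exact (Metropolis-corrected) sampling algorithms for lattice gauge theory; figures
of merit are autocorrelation/cost numbers at stated couplings and volumes; no continuum-physics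
claim.

The LATTICE HALF of the isoperimetric-transfer law (C2b′) of THEORY-2.md §3.3, for 2-d compact
`U(1)` configurations `U : Edge 2 L → Circle` on the torus `(ℤ/L)²`, sup (chordal) metric:
* `topCharge U = φ₀₁(0)/(2π) = (2π)⁻¹ ∑ₓ F₀₁(x)`, Lüscher's magnetic flux through the `(0,1)`-plane
  (`Literature…QuantumLattice.magneticFlux`, field tensor `F = arg U_p ∈ (−π, π]`), is an INTEGER
  (`exists_int_eq_topCharge`, from the Literature fact `exists_int_magneticFlux_eq`,
  [Luscher1999AbelianChiral, §2.2 (2.10)–(2.11)]).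
* COLLAR INCLUSION (`union_thickening_diff_subset_collar`), VOLUME-UNIFORM: for `A = {Q ≤ 0}`,
  `(A ∪ A^r) \ A ⊆ collar (4r) = {U | ∃ x, ‖U_p(x) + 1‖ ≤ 4r}`.  Proof: along the linkwise
  geodesic path from `U` to a configuration `U'` on the other side every configuration stays
  within `r` of `U`; if no plaquette of `U` were `4r`-close to `−1`, none along the path would hit
  `−1`, the charge would be continuous and integer-valued along the path, hence could not pass
  from `≥ 1` to `≤ 0` (intermediate value `1/2`).
* Hence `μ(A ∪ A^r) ≤ μ(A) + μ(collar 4r)` for EVERY finite measure `μ`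
  (`measureReal_union_thickening_le_collar`), and the abstract engine
  `Theory2.accurateTransport_lipschitz_ge` (`IsoperimetricTransfer.lean`) yields the
  **topological transport law** `accurateTransport_lipschitz_ge_collar`: prior `γ` with linear
  isoperimetric profile `(a, b, c)`, `T` `K`-Lipschitz with push-forward `ε`-close to `μ` on
  measurable sets, window `a ≤ μ(A) − ε`, `μ(A) + ε + μ(collar 4r) < b` ⟹
  `c·r ≤ K·(2ε + μ(collar 4r))`; exact case `exactTransport_lipschitz_ge_collar`.
NOT typed here (THEORY-2.md §3.3): the profile `(0.3, 0.8, 0.112)` of product Haar on `Circle^E`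
(Gaussian isoperimetry through the `√(2π)`-Lipschitz map `Φ ↦ e^{2πiΦ}`; Borell,
Sudakov–Tsirelson; Salmona et al. arXiv:2206.14476 Thm 1) — the hypothesis `hγ` — and the
one-plaquette collar mass `μ_β(collar η) ≤ #P·q_β(η)` of the Wilson measure.  Reused: the
chordal metric of `Circle` (`U1.dist_eq_norm_coe`, `CircleBallVolume.lean`), `arg` continuity off
`−1` (`Circle.mem_slitPlane_of_ne_neg_one`, `Literature…TorusMapDegree`), flux quantisation
(`Literature…AbelianMagneticFlux`).
-/


noncomputable section

namespace Summit.Ventures.LatticeQCDFlow.Theory2.Lattice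

open MeasureTheory Metric Set Filter Topology Real
open Literature.MathematicalPhysics.QuantumFieldTheory Literature.MathematicalPhysics.QuantumLattice

/-! ## §1. Chordal geometry of `Circle` and the plaquette map -/

section CircleGeometry

/-- Inversion is an isometry of `Circle` (it is complex conjugation). [folklore] -/
theorem Circle.dist_inv_inv (z w : Circle) : dist z⁻¹ w⁻¹ = dist z w := by
  rw [U1.dist_eq_norm_coe, U1.dist_eq_norm_coe, Circle.coe_inv_eq_conj,
    Circle.coe_inv_eq_conj, ← map_sub, Complex.norm_conj]

/-- Products move by at most the sum of the moves of the factors. [folklore] -/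
theorem Circle.dist_mul_mul_le (a b a' b' : Circle) :
    dist (a * b) (a' * b') ≤ dist a a' + dist b b' := by
  rw [U1.dist_eq_norm_coe, U1.dist_eq_norm_coe, U1.dist_eq_norm_coe, Circle.coe_mul,
    Circle.coe_mul]
  calc ‖(a : ℂ) * b - a' * b'‖ = ‖(a : ℂ) * (b - b') + (a - a') * b'‖ := by ring_nf
    _ ≤ ‖(a : ℂ) * (b - b')‖ + ‖((a : ℂ) - a') * b'‖ := norm_add_le _ _
    _ = ‖(b : ℂ) - b'‖ + ‖(a : ℂ) - a'‖ := by
        rw [norm_mul, norm_mul, Circle.norm_coe, Circle.norm_coe, one_mul, mul_one]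
    _ = ‖(a : ℂ) - a'‖ + ‖(b : ℂ) - b'‖ := add_comm _ _

/-- Left multiplication by `Circle.exp s` moves every point by the chord `|2 sin(s/2)|`. [folklore] -/
theorem Circle.dist_exp_mul_self (s : ℝ) (u : Circle) :
    dist (Circle.exp s * u) u = |2 * Real.sin (s / 2)| := by
  rw [U1.dist_eq_norm_coe, Circle.coe_mul, Circle.coe_exp]
  have : Complex.exp (s * Complex.I) * (u : ℂ) - u = (Complex.exp (Complex.I * s) - 1) * u := by
    rw [mul_comm (s : ℂ) Complex.I]; ring
  rw [this, norm_mul, Circle.norm_coe, mul_one, Complex.norm_exp_I_mul_ofReal_sub_one,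
    Real.norm_eq_abs]

/-- `|sin|` is monotone in `|·|` on `[−π/2, π/2]`. [folklore] -/
theorem abs_sin_le_abs_sin {a b : ℝ} (hab : |a| ≤ |b|) (hb : |b| ≤ π / 2) :
    |Real.sin a| ≤ |Real.sin b| := by
  have key : ∀ x : ℝ, |x| ≤ π / 2 → |Real.sin x| = Real.sin |x| := by
    intro x hx
    rcases le_or_gt 0 x with h | h
    · rw [abs_of_nonneg h, abs_of_nonneg (Real.sin_nonneg_of_nonneg_of_le_pi h
        (by linarith [le_abs_self x, Real.pi_pos]))]
    · rw [abs_of_neg h]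
      have : 0 ≤ Real.sin (-x) :=
        Real.sin_nonneg_of_nonneg_of_le_pi (by linarith) (by rw [abs_of_neg h] at hx; linarith)
      rw [Real.sin_neg] at this
      rw [abs_of_nonpos (by linarith), Real.sin_neg]
  rw [key a (hab.trans hb), key b hb]
  exact Real.sin_le_sin_of_le_of_le_pi_div_two (by linarith [abs_nonneg a, Real.pi_pos]) hb hab

/-- Moving part of the way along the minor arc moves at most as far (chordally): for `|δ| ≤ π` and
`t ∈ [0, 1]`, `dist (exp(tδ)·u, u) ≤ dist (exp(δ)·u, u)`. [folklore] -/
theorem Circle.dist_exp_mul_le_of_mem_Icc {δ : ℝ} (hδ : |δ| ≤ π) {t : ℝ} (ht : t ∈ Icc (0 : ℝ) 1)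
    (u : Circle) : dist (Circle.exp (t * δ) * u) u ≤ dist (Circle.exp δ * u) u := by
  rw [Circle.dist_exp_mul_self, Circle.dist_exp_mul_self, abs_mul, abs_mul]
  refine mul_le_mul_of_nonneg_left (abs_sin_le_abs_sin ?_ ?_) (abs_nonneg _)
  · rw [mul_div_assoc, abs_mul, abs_of_nonneg ht.1]
    exact (mul_le_mul_of_nonneg_right ht.2 (abs_nonneg _)).trans_eq (one_mul _)
  · rw [abs_div, abs_two]; linarith

variable {d L : ℕ} [NeZero L]

/-- Four-factor version of `Circle.dist_mul_mul_le` in the plaquette pattern `a b c⁻¹ e⁻¹`. [folklore] -/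
theorem Circle.dist_plaquettePattern_le (a b c e a' b' c' e' : Circle) :
    dist (a * b * c⁻¹ * e⁻¹) (a' * b' * c'⁻¹ * e'⁻¹) ≤ dist a a' + dist b b' + dist c c' + dist e e' := by
  have h1 := Circle.dist_mul_mul_le (a * b * c⁻¹) e⁻¹ (a' * b' * c'⁻¹) e'⁻¹
  have h2 := Circle.dist_mul_mul_le (a * b) c⁻¹ (a' * b') c'⁻¹
  have h3 := Circle.dist_mul_mul_le a b a' b'
  rw [Circle.dist_inv_inv] at h1 h2
  linarith

/-- The plaquette map is `4`-Lipschitz for the sup (chordal) metric on configurations. [folklore] -/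
theorem dist_plaquetteHolonomy_le (U V : GaugeConfig d L Circle) (x : Site d L) (i j : Fin d) :
    dist (plaquetteHolonomy U x i j) (plaquetteHolonomy V x i j) ≤ 4 * dist U V := by
  unfold plaquetteHolonomy
  have h := Circle.dist_plaquettePattern_le (U (x, i)) (U (x.shift i, j)) (U (x.shift j, i)) (U (x, j))
    (V (x, i)) (V (x.shift i, j)) (V (x.shift j, i)) (V (x, j))
  have h1 := dist_le_pi_dist U V (x, i)
  have h2 := dist_le_pi_dist U V (x.shift i, j)
  have h3 := dist_le_pi_dist U V (x.shift j, i)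
  have h4 := dist_le_pi_dist U V (x, j)
  exact h.trans (by linarith)

omit [NeZero L] in
/-- The plaquette map is continuous in the configuration. [folklore] -/
theorem continuous_plaquetteHolonomy (x : Site d L) (i j : Fin d) :
    Continuous fun U : GaugeConfig d L Circle => plaquetteHolonomy U x i j := by
  unfold plaquetteHolonomy
  fun_prop

end CircleGeometry

/-! ## §2. The topological charge of a 2-d abelian configuration is an integer -/

section Charge

variable {L : ℕ} [NeZero L]

/-- The topological charge of a 2-d `U(1)` configuration: Lüscher's magnetic flux through the
`(0,1)`-plane, `Q(U) = φ₀₁(0)/(2π) = (2π)⁻¹ ∑ₓ F₀₁(x)` with `F₀₁(x) = arg U_p(x) ∈ (−π, π]`.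
[cite: Luscher1999AbelianChiral, §2.2, eq. (2.10)] -/
def topCharge (U : GaugeConfig 2 L Circle) : ℝ := magneticFlux U 0 0 1 / (2 * π)

/-- The topological charge is an integer (flux quantisation). [cite: Luscher1999AbelianChiral, §2.2, eq. (2.11)] -/
theorem exists_int_eq_topCharge (U : GaugeConfig 2 L Circle) : ∃ n : ℤ, topCharge U = n := by
  obtain ⟨n, hn⟩ := exists_int_magneticFlux_eq U 0 0 1
  refine ⟨n, ?_⟩
  have hπ : (2 : ℝ) * π ≠ 0 := by positivity
  rw [topCharge, hn]
  field_simp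

/-- A configuration of positive charge has charge at least one. [folklore] -/
theorem one_le_topCharge_of_pos {U : GaugeConfig 2 L Circle} (h : 0 < topCharge U) :
    1 ≤ topCharge U := by
  obtain ⟨n, hn⟩ := exists_int_eq_topCharge U
  rw [hn] at h ⊢
  have h0 : (0 : ℤ) < n := by exact_mod_cast h
  have h1 : (1 : ℤ) ≤ n := by omega
  exact_mod_cast h1

/-- The charge `1/2` does not occur. [folklore] -/
theorem topCharge_ne_half (U : GaugeConfig 2 L Circle) : topCharge U ≠ 1 / 2 := by
  obtain ⟨n, hn⟩ := exists_int_eq_topCharge U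
  rw [hn]
  intro h
  have h2 : ((2 * n : ℤ) : ℝ) = ((1 : ℤ) : ℝ) := by push_cast; linarith
  have h3 : 2 * n = 1 := by exact_mod_cast h2
  omega

/-- The topological charge is measurable. [folklore] -/
theorem measurable_topCharge : Measurable (topCharge (L := L)) := by
  unfold topCharge magneticFlux abelianFieldTensor
  refine Measurable.div_const (Finset.measurable_sum _ fun s _ =>
    Finset.measurable_sum _ fun t _ => ?_) _
  exact Complex.measurable_arg.comp
    (continuous_subtype_val.comp (continuous_plaquetteHolonomy _ 0 1)).measurable

/-- The topological half-space `{Q ≤ 0}` is measurable. [folklore] -/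
theorem measurableSet_topCharge_le :
    MeasurableSet {U : GaugeConfig 2 L Circle | topCharge U ≤ 0} :=
  measurable_topCharge measurableSet_Iic

end Charge

/-! ## §3. The linkwise geodesic path and the collar inclusion -/

section Collar

variable {L : ℕ} [NeZero L]

/-- The linkwise geodesic path from `U` (`t = 0`) to `U'` (`t = 1`). [folklore] -/
def anglePath (U U' : GaugeConfig 2 L Circle) (t : ℝ) : GaugeConfig 2 L Circle :=
  fun e => Circle.exp (t * Complex.arg ((U' e / U e : Circle) : ℂ)) * U e

omit [NeZero L] in
/-- The path starts at `U`. [folklore] -/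
theorem anglePath_zero (U U' : GaugeConfig 2 L Circle) : anglePath U U' 0 = U := by
  funext e; simp [anglePath, Circle.exp_zero]

omit [NeZero L] in
/-- The path ends at `U'`. [folklore] -/
theorem anglePath_one (U U' : GaugeConfig 2 L Circle) : anglePath U U' 1 = U' := by
  funext e
  simp only [anglePath, one_mul, Circle.exp_arg]
  exact div_mul_cancel (U' e) (U e)

/-- Every configuration on the path is within `dist U' U` of `U` (sup metric). [folklore] -/
theorem dist_anglePath_le (U U' : GaugeConfig 2 L Circle) {t : ℝ} (ht : t ∈ Icc (0 : ℝ) 1) :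
    dist (anglePath U U' t) U ≤ dist U' U := by
  refine (dist_pi_le_iff dist_nonneg).2 fun e => ?_
  have hδ : |Complex.arg ((U' e / U e : Circle) : ℂ)| ≤ π :=
    abs_le.2 ⟨(Complex.neg_pi_lt_arg _).le, Complex.arg_le_pi _⟩
  have hU' : U' e = Circle.exp (Complex.arg ((U' e / U e : Circle) : ℂ)) * U e := by
    rw [Circle.exp_arg]; exact (div_mul_cancel (U' e) (U e)).symm
  calc dist (anglePath U U' t e) (U e)
      = dist (Circle.exp (t * Complex.arg ((U' e / U e : Circle) : ℂ)) * U e) (U e) := rfl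
    _ ≤ dist (Circle.exp (Complex.arg ((U' e / U e : Circle) : ℂ)) * U e) (U e) :=
        Circle.dist_exp_mul_le_of_mem_Icc hδ ht (U e)
    _ = dist (U' e) (U e) := by rw [← hU']
    _ ≤ dist U' U := dist_le_pi_dist U' U e

omit [NeZero L] in
/-- The path is continuous in `t`. [folklore] -/
theorem continuous_anglePath (U U' : GaugeConfig 2 L Circle) : Continuous (anglePath U U') := by
  refine continuous_pi fun e => ?_
  exact (Circle.exp.continuous.comp (continuous_id.mul continuous_const)).mul continuous_const

/-- The `s`-collar of the sector boundary: some plaquette is within chordal distance `s` of `−1`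
(plaquette angle within `≈ s` of `π`). [folklore] -/
def collar (s : ℝ) : Set (GaugeConfig 2 L Circle) :=
  {U | ∃ x : Site 2 L, ‖((plaquetteHolonomy U x 0 1 : Circle) : ℂ) + 1‖ ≤ s}

/-- **Collar inclusion (volume-uniform).**  A configuration of positive charge within sup-distance
`r` of a configuration of non-positive charge has a plaquette within chordal distance `4r` of `−1`:
`(A ∪ A^r) \ A ⊆ collar (4r)` for `A = {Q ≤ 0}`. [folklore] -/
theorem union_thickening_diff_subset_collar (r : ℝ) :
    ({U : GaugeConfig 2 L Circle | topCharge U ≤ 0} ∪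
        thickening r {U : GaugeConfig 2 L Circle | topCharge U ≤ 0}) \
      {U | topCharge U ≤ 0} ⊆ collar (4 * r) := by
  rintro U ⟨hU, hUA⟩
  have hUA' : ¬ topCharge U ≤ 0 := hUA
  rcases hU with hU | hU
  · exact absurd hU hUA'
  rw [mem_thickening_iff] at hU
  obtain ⟨U', hU'A, hUU'⟩ := hU
  have hU'A' : topCharge U' ≤ 0 := hU'A
  by_contra hcol
  have hfar : ∀ x : Site 2 L, 4 * r < ‖((plaquetteHolonomy U x 0 1 : Circle) : ℂ) + 1‖ := by
    intro x; by_contra hx; exact hcol ⟨x, not_lt.mp hx⟩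
  -- along the linkwise geodesic path no plaquette hits `-1`
  have hne : ∀ t ∈ Icc (0 : ℝ) 1, ∀ x : Site 2 L,
      plaquetteHolonomy (anglePath U U' t) x 0 1 ≠ -1 := by
    intro t ht x hx
    have hd : dist (plaquetteHolonomy (anglePath U U' t) x 0 1) (plaquetteHolonomy U x 0 1) < 4 * r :=
      calc dist (plaquetteHolonomy (anglePath U U' t) x 0 1) (plaquetteHolonomy U x 0 1)
          ≤ 4 * dist (anglePath U U' t) U := dist_plaquetteHolonomy_le _ _ _ _ _
        _ ≤ 4 * dist U' U := by linarith [dist_anglePath_le U U' ht]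
        _ < 4 * r := by rw [dist_comm]; linarith
    have h' : ‖((-1 : Circle) : ℂ) - ((plaquetteHolonomy U x 0 1 : Circle) : ℂ)‖ < 4 * r := by
      rw [← U1.dist_eq_norm_coe, ← hx]; exact hd
    have e : ((-1 : Circle) : ℂ) - ((plaquetteHolonomy U x 0 1 : Circle) : ℂ) =
        -(((plaquetteHolonomy U x 0 1 : Circle) : ℂ) + 1) := by
      rw [Circle.coe_neg, Circle.coe_one]; ring
    rw [e, norm_neg] at h'
    exact absurd h' (not_lt.mpr (hfar x).le)
  -- hence the charge is continuous along the path
  have hF : ∀ x : Site 2 L,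
      ContinuousOn (fun t => abelianFieldTensor (anglePath U U' t) x 0 1) (Icc (0 : ℝ) 1) := by
    intro x t ht
    have hc : Continuous fun s => ((plaquetteHolonomy (anglePath U U' s) x 0 1 : Circle) : ℂ) :=
      continuous_subtype_val.comp
        ((continuous_plaquetteHolonomy x 0 1).comp (continuous_anglePath U U'))
    have h2 : ContinuousAt (fun s => Complex.arg ((plaquetteHolonomy (anglePath U U' s) x 0 1 :
        Circle) : ℂ)) t :=
      ContinuousAt.comp (g := Complex.arg)
        (f := fun s => ((plaquetteHolonomy (anglePath U U' s) x 0 1 : Circle) : ℂ))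
        (Complex.continuousAt_arg (Circle.mem_slitPlane_of_ne_neg_one _ (hne t ht x)))
        hc.continuousAt
    exact h2.continuousWithinAt
  have hcont : ContinuousOn (fun t => topCharge (anglePath U U' t)) (Icc (0 : ℝ) 1) := by
    unfold topCharge magneticFlux
    exact ContinuousOn.div_const (continuousOn_finsetSum _ fun a _ =>
      continuousOn_finsetSum _ fun b _ => hF _) _
  -- intermediate value `1/2` between `Q(U') ≤ 0` and `Q(U) ≥ 1`
  have h0 : topCharge (anglePath U U' 0) = topCharge U := by rw [anglePath_zero]
  have h1 : topCharge (anglePath U U' 1) = topCharge U' := by rw [anglePath_one]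
  have hQU : 1 ≤ topCharge U := one_le_topCharge_of_pos (not_le.mp hUA')
  have hmem : (1 / 2 : ℝ) ∈ Icc (topCharge (anglePath U U' 1)) (topCharge (anglePath U U' 0)) := by
    rw [h0, h1]; exact ⟨by linarith, by linarith⟩
  obtain ⟨t, _, ht⟩ := intermediate_value_Icc' zero_le_one hcont hmem
  exact topCharge_ne_half (anglePath U U' t) ht

/-- **Collar bound for every finite measure**: `μ(A ∪ A^r) ≤ μ(A) + μ(collar 4r)`. [folklore] -/
theorem measureReal_union_thickening_le_collar (μ : Measure (GaugeConfig 2 L Circle))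
    [IsFiniteMeasure μ] (r : ℝ) :
    μ.real ({U | topCharge U ≤ 0} ∪ thickening r {U | topCharge U ≤ 0}) ≤
      μ.real {U | topCharge U ≤ 0} + μ.real (collar (4 * r)) := by
  refine (measureReal_mono (fun U hU => ?_) (measure_ne_top _ _)).trans (measureReal_union_le _ _)
  by_cases hA : topCharge U ≤ 0
  · exact Or.inl hA
  · exact Or.inr (union_thickening_diff_subset_collar r ⟨hU, hA⟩)

end Collar

/-! ## §4. The topological transport law for 2-d `U(1)` -/

section Law

variable {L : ℕ} [NeZero L]

/-- **Topological transport law (C2b′), lattice half PROVED.**  Let `γ` be a finite prior on a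
metric space with the linear isoperimetric profile `(a, b, c)` (`min(γ(B) + c·s, b) ≤ γ(B ∪ B^s)`
whenever `γ(B) ≥ a`), `T` a `K`-Lipschitz map into 2-d `U(1)` configurations (sup metric) whose
push-forward is `ε`-close to a finite measure `μ` on measurable sets, `A = {Q ≤ 0}`, and suppose
the window `a ≤ μ(A) − ε`, `μ(A) + ε + μ(collar 4r) < b`.  Then `c·r ≤ K·(2ε + μ(collar 4r))`:
the Lipschitz cost is linear in `1/ε` and capped by the collar mass. [folklore] -/
theorem accurateTransport_lipschitz_ge_collar {Y : Type*} [PseudoMetricSpace Y] [MeasurableSpace Y]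
    [OpensMeasurableSpace Y] {γ : Measure Y} [IsFiniteMeasure γ] {a b c : ℝ}
    (hγ : ∀ B : Set Y, MeasurableSet B → a ≤ γ.real B → ∀ s : ℝ, 0 ≤ s →
      min (γ.real B + c * s) b ≤ γ.real (B ∪ thickening s B))
    {T : Y → GaugeConfig 2 L Circle} {K : NNReal} (hT : LipschitzWith K T) (hK : 0 < (K : ℝ))
    {μ : Measure (GaugeConfig 2 L Circle)} [IsFiniteMeasure μ] {r ε : ℝ} (hr : 0 ≤ r)
    (hacc : ∀ S : Set (GaugeConfig 2 L Circle), MeasurableSet S → |μ.real S - (γ.map T).real S| ≤ ε)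
    (ha : a ≤ μ.real {U | topCharge U ≤ 0} - ε)
    (hb : μ.real {U | topCharge U ≤ 0} + ε + μ.real (collar (4 * r)) < b) :
    c * r ≤ K * (2 * ε + μ.real (collar (4 * r))) := by
  have hA : MeasurableSet {U : GaugeConfig 2 L Circle | topCharge U ≤ 0} :=
    measurableSet_topCharge_le
  obtain ⟨h₁, h₂⟩ := Theory2.setwise_of_forall hacc hA r
  exact Theory2.accurateTransport_lipschitz_ge hγ hT hK hA hr h₁ h₂
    (measureReal_union_thickening_le_collar μ r) ha hb

/-- **Exact case**: an EXACT `K`-Lipschitz transport `T_*γ = μ` obeys `c·r ≤ K·μ(collar 4r)`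
whenever `a ≤ μ(A)` and `μ(A) + μ(collar 4r) < b`. [folklore] -/
theorem exactTransport_lipschitz_ge_collar {Y : Type*} [PseudoMetricSpace Y] [MeasurableSpace Y]
    [OpensMeasurableSpace Y] {γ : Measure Y} [IsFiniteMeasure γ] {a b c : ℝ}
    (hγ : ∀ B : Set Y, MeasurableSet B → a ≤ γ.real B → ∀ s : ℝ, 0 ≤ s →
      min (γ.real B + c * s) b ≤ γ.real (B ∪ thickening s B))
    {T : Y → GaugeConfig 2 L Circle} {K : NNReal} (hT : LipschitzWith K T) (hK : 0 < (K : ℝ))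
    {μ : Measure (GaugeConfig 2 L Circle)} [IsFiniteMeasure μ] (hex : γ.map T = μ) {r : ℝ}
    (hr : 0 ≤ r) (ha : a ≤ μ.real {U | topCharge U ≤ 0})
    (hb : μ.real {U | topCharge U ≤ 0} + μ.real (collar (4 * r)) < b) :
    c * r ≤ K * μ.real (collar (4 * r)) :=
  Theory2.exactTransport_lipschitz_ge hγ hT hK hex measurableSet_topCharge_le hr
    (measureReal_union_thickening_le_collar μ r) ha hb

end Law

end Summit.Ventures.LatticeQCDFlow.Theory2.Lattice

end
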